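import Mathlib
import Literature.Analysis.FluidPDE.VectorCalculus
import Literature.Analysis.FluidPDE.VorticityCalculus
import Literature.Analysis.FluidPDE.TaoEnstrophyLocalisation
import Literature.Analysis.FluidPDE.LandauSolutions
import Literature.Analysis.FluidPDE.SverakLandauClassificationProofs
import Summits.NavierStokesRegularity.NavierStokesRegularity.Theorems.TypeIQuarterGateScarEnvelopeTypeIForcedTsaiTailDichotomy
import Summits.NavierStokesRegularity.NavierStokesRegularity.Theorems.ThreadingFluxAzimuthalCartanLocalCurlCurl
import Summits.NavierStokesRegularity.NavierStokesRegularity.Theorems.ThreadingFluxCentreJetLocalDriftLaw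
import Summits.NavierStokesRegularity.NavierStokesRegularity.Theorems.ThreadingFluxCentreJetRigidityReduction
import Summits.NavierStokesRegularity.NavierStokesRegularity.Theorems.ThreadingFluxAzimuthalCartanDefs
import Summits.NavierStokesRegularity.NavierStokesRegularity.Theorems.ThreadingFluxAzimuthalCartanShellReduction
import Summits.NavierStokesRegularity.NavierStokesRegularity.Theorems.ThreadingFluxAzimuthalCartanLandauBaseTools
import Summits.NavierStokesRegularity.NavierStokesRegularity.Theorems.ThreadingFluxAzimuthalCartanShellHomogeneousExtension
import HarnessLib

/-!
# Crux `PoloidalLiouville` (stmt-NavierStokesRegularity-1222, wall W1), crux idea «azimuthal-cartan-test» (ns-idea-15 g10,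
# `Cruxes/PoloidalLiouville/AzimuthalCartanSketch.lean` v1.3c): C♯ ON THE SCALE-INVARIANT STRATUM, II — `SteadyShellRigidity`
# HOLDS for flows homogeneous of degree −1 about the centre

Support file (Theorems-side; seat ns-wall-eng-6 g4, cell `ns-wall-extremal`, W1 adjunct; `--supports stmt-NavierStokesRegularity-1222
--as helper`; 0 kit).

* `Homogeneous.landau_of_homogeneous` — an analytic classical steady Navier–Stokes flow on a full spherical shell about `x₀`,
  `(−1)`-homogeneous about `x₀` there (`IsMinusOneHomogeneousOn`) and with `curl ≢ 0`, IS a Landau flow centred at `x₀` on the shell: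
  `V x = landauAxisField a A (x − x₀)` (translation to the shell about `0` + file I);
* `Homogeneous.landau_equivariant_noSwirl` — a Landau flow is infinitesimally axisymmetric about its own axis through the centre with
  zero swirl, for ANY unit axis `a`: ns-wall-eng-8 g5's `LandauBase.fderiv_landau_crossCLM_e2` / `inner_landau_crossCLM_e2` (axis
  `e₂`) transported along `landauAxisField_map_linearIsometryEquiv` with the CONJUGATED GENERATOR `conjGen R = R ∘ J₃ ∘ R⁻¹`
  (`isSkewAxis_conjGen`; the frame `R e₂ = a` is the tree's `exists_linearIsometryEquiv_apply_eZ_eq`, a reflection — no determinant);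
* ★★ `Homogeneous.steadyShellRigidity_of_homogeneous` — the body of C♯ `SteadyShellRigidity` with the extra hypothesis
  `IsMinusOneHomogeneousOn (shell x₀ r₁ r₂) x₀ V` (and WITHOUT needing the unthreaded hypothesis): C♯ holds on the scale-invariant
  stratum — the stratum where the BALL statements of the card fail off the vertex (K♯).

HONEST LABEL: a POSITIVE stratum theorem for the card's conjecture C♯ (information-grade, W1 movement 0); C♯ itself,
`PoloidalLiouville` (1222), its steady stratum and NS regularity stay OPEN and untouched.  [cite: Sverak2011, §1 Theorem 1]
-/

-- the summit and its single problem share the name (D-0017 nested layout)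
set_option linter.dupNamespace false

noncomputable section

open Set Function Filter Metric
open scoped RealInnerProductSpace Topology Laplacian
open Literature.Analysis.FluidPDE
open Summit.NavierStokesRegularity.NavierStokesRegularity.Theorems.PoloidalLiouville.CentreJet (E3 IsUnthreadedAbout IsSteadyNSOn)
open Summit.NavierStokesRegularity.NavierStokesRegularity.Cruxes.ScarEnvelopeTypeI.ForcedTsai (TailDichotomy.steadyResidual_smul'
  TailDichotomy.steadyResidual_rescale_eq TailDichotomy.curl_steadyResidual_smul' TailDichotomy.divergence_smul_of_homogeneous
  TailDichotomy.gradient_pressure_eq TailDichotomy.steadyResidual_congr)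

namespace Summit.NavierStokesRegularity.NavierStokesRegularity.Theorems.PoloidalLiouville.AzimuthalCartan

namespace Homogeneous

/-! ### From the shell about `x₀` to the shell about `0` -/

section Translate

variable {V : E3 → E3} {p : E3 → ℝ} {x₀ : E3} {r₁ r₂ : ℝ}

/-- The translated velocity is analytic on the shell about `0`. -/
theorem analyticOnNhd_translate (hV : AnalyticOnNhd ℝ V (shell x₀ r₁ r₂)) :
    AnalyticOnNhd ℝ (fun y => V (x₀ + y)) (shell (0 : E3) r₁ r₂) := by
  intro y hy
  have h : AnalyticAt ℝ V (x₀ + y) := hV _ (add_mem_shell.2 hy)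
  exact h.comp (analyticAt_const.add analyticAt_id)

/-- The translated pressure is analytic on the shell about `0`. -/
theorem analyticOnNhd_translate_scalar (hp : AnalyticOnNhd ℝ p (shell x₀ r₁ r₂)) :
    AnalyticOnNhd ℝ (fun y => p (x₀ + y)) (shell (0 : E3) r₁ r₂) := by
  intro y hy
  have h : AnalyticAt ℝ p (x₀ + y) := hp _ (add_mem_shell.2 hy)
  exact h.comp (analyticAt_const.add analyticAt_id)

/-- Translation covariance of the classical steady system on the shell. -/
theorem isSteadyNSOn_translate (hNS : IsSteadyNSOn (shell x₀ r₁ r₂) V p) :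
    IsSteadyNSOn (shell (0 : E3) r₁ r₂) (fun y => V (x₀ + y)) (fun y => p (x₀ + y)) := by
  obtain ⟨hVc, hpc, hdiv, heq⟩ := hNS
  have hmaps : MapsTo (fun y : E3 => x₀ + y) (shell (0 : E3) r₁ r₂) (shell x₀ r₁ r₂) := fun y hy => add_mem_shell.2 hy
  have haff : ContDiff ℝ 3 (fun y : E3 => x₀ + y) := contDiff_const.add contDiff_id
  have haff1 : ContDiff ℝ 1 (fun y : E3 => x₀ + y) := contDiff_const.add contDiff_id
  refine ⟨hVc.comp haff.contDiffOn hmaps, hpc.comp haff1.contDiffOn hmaps, fun y hy => ?_, fun y hy => ?_⟩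
  · rw [CentreJet.divergence_comp_const_add]; exact hdiv _ (hmaps hy)
  · rw [fderiv_comp_add_left, CentreJet.gradient_comp_const_add, CentreJet.laplacian_comp_const_add]
    exact heq _ (hmaps hy)

/-- Euler's identity transfers to the translated field. -/
theorem euler_translate (hhom : IsMinusOneHomogeneousOn (shell x₀ r₁ r₂) x₀ V) :
    ∀ y ∈ shell (0 : E3) r₁ r₂, fderiv ℝ (fun z => V (x₀ + z)) y y = -(V (x₀ + y)) := by
  intro y hy
  rw [fderiv_comp_add_left]
  have h := hhom (x₀ + y) (add_mem_shell.2 hy)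
  rwa [add_sub_cancel_left] at h

/-- A point of non-zero vorticity transfers. -/
theorem curl_translate_ne (hcurl : ∃ x ∈ shell x₀ r₁ r₂, curl V x ≠ 0) :
    ∃ y ∈ shell (0 : E3) r₁ r₂, curl (fun z => V (x₀ + z)) y ≠ 0 := by
  obtain ⟨x, hx, hc⟩ := hcurl
  refine ⟨x - x₀, sub_mem_shell_zero.2 hx, ?_⟩
  rwa [curl_eq_curlCLM, fderiv_comp_add_left, add_sub_cancel, ← curl_eq_curlCLM]

/-- ★ **On the scale-invariant stratum the flow is LANDAU about the centre.**  An analytic classical steady Navier–Stokes flow on a full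
spherical shell about `x₀`, `(−1)`-homogeneous about `x₀` there and with `curl ≢ 0`, coincides on the shell with a Landau solution
centred at `x₀`: `V x = landauAxisField a A (x − x₀)` (`‖a‖ = 1`, `A > 1`). -/
theorem landau_of_homogeneous (hr₁ : 0 < r₁) (h₁₂ : r₁ < r₂)
    (hV : AnalyticOnNhd ℝ V (shell x₀ r₁ r₂)) (hp : AnalyticOnNhd ℝ p (shell x₀ r₁ r₂))
    (hNS : IsSteadyNSOn (shell x₀ r₁ r₂) V p) (hcurl : ∃ x ∈ shell x₀ r₁ r₂, curl V x ≠ 0)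
    (hhom : IsMinusOneHomogeneousOn (shell x₀ r₁ r₂) x₀ V) :
    ∃ a : E3, ‖a‖ = 1 ∧ ∃ A : ℝ, 1 < A ∧ ∀ x ∈ shell x₀ r₁ r₂, V x = landauAxisField a A (x - x₀) := by
  obtain ⟨a, ha, A, hA, hL⟩ := eq_landau_on_shell hr₁ h₁₂ (analyticOnNhd_translate hV) (analyticOnNhd_translate_scalar hp)
    (isSteadyNSOn_translate hNS) (euler_translate hhom) (curl_translate_ne hcurl)
  refine ⟨a, ha, A, hA, fun x hx => ?_⟩
  have h := hL (x - x₀) (sub_mem_shell_zero.2 hx)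
  rwa [add_sub_cancel] at h

end Translate

/-! ### Landau flows are infinitesimally axisymmetric about their axis with zero swirl (any unit axis, any centre) -/

section Landau

variable {a : E3} {A : ℝ} {x₀ : E3} {r₁ r₂ : ℝ} {V : E3 → E3}

/-- The conjugated rotation generator `R ∘ J₃ ∘ R⁻¹` of a linear isometry `R`. -/
def conjGen (R : E3 ≃ₗᵢ[ℝ] E3) : E3 →L[ℝ] E3 :=
  (R.toContinuousLinearEquiv : E3 →L[ℝ] E3).comp
    ((crossCLM (EuclideanSpace.single 2 1)).comp (R.symm.toContinuousLinearEquiv : E3 →L[ℝ] E3))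

/-- `conjGen R y = R (e₂ × R⁻¹ y)`. -/
theorem conjGen_apply (R : E3 ≃ₗᵢ[ℝ] E3) (y : E3) :
    conjGen R y = R (crossCLM (EuclideanSpace.single 2 1) (R.symm y)) := rfl

/-- `conjGen R` is a non-zero skew endomorphism. -/
theorem isSkewAxis_conjGen (R : E3 ≃ₗᵢ[ℝ] E3) : IsSkewAxis (conjGen R) := by
  refine ⟨fun x => ?_, fun h => ?_⟩
  · have h := R.inner_map_map (crossCLM (EuclideanSpace.single 2 1) (R.symm x)) (R.symm x)
    rw [LinearIsometryEquiv.apply_symm_apply] at h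
    rw [conjGen_apply, h]
    exact LandauBase.inner_crossCLM_e2_self (R.symm x)
  · apply LandauBase.crossCLM_e2_ne_zero
    ext y i
    have h1 := congrArg (fun B : E3 →L[ℝ] E3 => R.symm (B (R y))) h
    simp only [conjGen_apply, LinearIsometryEquiv.symm_apply_apply, _root_.zero_apply, map_zero] at h1
    rw [h1]; rfl

/-- **Equivariance and zero swirl of a Landau field about its own axis through the centre.**  If `V = landauAxisField a A (· − x₀)`
on the shell (`‖a‖ = 1`, `|A| > 1`) then, with `R` a linear isometry carrying `e₂` to `a`, the generator `R ∘ J₃ ∘ R⁻¹` is an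
infinitesimal symmetry of `V` about `x₀` on the shell and the swirl about it vanishes. -/
theorem landau_equivariant_noSwirl (hA : 1 < |A|) (hr₁ : 0 < r₁) {R : E3 ≃ₗᵢ[ℝ] E3}
    (hR : R (EuclideanSpace.single 2 1) = a) (hV : ∀ x ∈ shell x₀ r₁ r₂, V x = landauAxisField a A (x - x₀)) :
    IsEquivariantOn (shell x₀ r₁ r₂) x₀ (conjGen R) V ∧ HasConstantSwirlOn (shell x₀ r₁ r₂) x₀ (conjGen R) V := by
  set L₂ : E3 → E3 := landauAxisField (EuclideanSpace.single 2 1) A with hL₂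
  -- `landauAxisField a A y = R (L₂ (R⁻¹ y))`
  have hL : ∀ y : E3, landauAxisField a A y = R (L₂ (R.symm y)) := by
    intro y
    have h := landauAxisField_map_linearIsometryEquiv R (EuclideanSpace.single 2 1) A (R.symm y)
    rw [hR, LinearIsometryEquiv.apply_symm_apply] at h
    exact h
  have hne : ∀ {x : E3}, x ∈ shell x₀ r₁ r₂ → R.symm (x - x₀) ≠ 0 := by
    intro x hx h0
    have : x - x₀ = 0 := by simpa using congrArg R h0
    exact ne_zero_of_mem_shell hr₁.le (sub_mem_shell_zero.2 hx) this
  refine ⟨fun x hx => ?_, ⟨0, fun x hx => ?_⟩⟩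
  · -- equivariance
    have hVeq : V =ᶠ[𝓝 x] fun z => R (L₂ (R.symm (z - x₀))) := by
      filter_upwards [((isOpen_Ioo.preimage (continuous_id.dist continuous_const) : IsOpen (shell x₀ r₁ r₂))).mem_nhds hx] with z hz
      rw [hV z hz, hL]
    have hw := hne hx
    have hd : DifferentiableAt ℝ L₂ (R.symm (x - x₀)) :=
      (LandauTail.contDiffAt_landauAxisField LandauBase.norm_e2 hA hw (n := 1)).differentiableAt one_ne_zero
    -- chain rule for `z ↦ R (L₂ (R⁻¹ (z − x₀)))`
    have hchain : HasFDerivAt (fun z : E3 => R (L₂ (R.symm (z - x₀))))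
        ((R.toContinuousLinearEquiv : E3 →L[ℝ] E3).comp ((fderiv ℝ L₂ (R.symm (x - x₀))).comp
          (R.symm.toContinuousLinearEquiv : E3 →L[ℝ] E3))) x := by
      have h1 : HasFDerivAt (fun z : E3 => R.symm (z - x₀)) (R.symm.toContinuousLinearEquiv : E3 →L[ℝ] E3) x := by
        have h0 : HasFDerivAt (fun z : E3 => z - x₀) (ContinuousLinearMap.id ℝ E3) x := (hasFDerivAt_id x).sub_const x₀
        exact ((R.symm.toContinuousLinearEquiv : E3 →L[ℝ] E3).hasFDerivAt.comp x h0).congr_fderiv (by ext v; simp)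
      have h2 : HasFDerivAt (fun z : E3 => L₂ (R.symm (z - x₀)))
          ((fderiv ℝ L₂ (R.symm (x - x₀))).comp (R.symm.toContinuousLinearEquiv : E3 →L[ℝ] E3)) x :=
        HasFDerivAt.comp (f := fun z : E3 => R.symm (z - x₀)) x hd.hasFDerivAt h1
      exact HasFDerivAt.comp (f := fun z : E3 => L₂ (R.symm (z - x₀))) x
        (R.toContinuousLinearEquiv : E3 →L[ℝ] E3).hasFDerivAt h2
    rw [hVeq.fderiv_eq, hchain.fderiv]
    simp only [ContinuousLinearMap.comp_apply, ContinuousLinearEquiv.coe_coe, LinearIsometryEquiv.coe_toContinuousLinearEquiv,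
      conjGen_apply, LinearIsometryEquiv.symm_apply_apply]
    have h2 := LandauBase.fderiv_landau_crossCLM_e2 hA hw 0
    rw [zero_smul, sub_zero] at h2
    rw [h2, hV x hx, hL, LinearIsometryEquiv.symm_apply_apply]
  · -- swirl
    rw [hV x hx, hL, conjGen_apply, LinearIsometryEquiv.inner_map_map]
    have h2 := LandauBase.inner_landau_crossCLM_e2 A (R.symm (x - x₀)) 0
    rwa [zero_smul, sub_zero] at h2

end Landau

/-! ### Assembly -/

/-- ★★ **C♯ on the scale-invariant stratum.**  `SteadyShellRigidity` (the card's conjecture) HOLDS for flows that are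
`(−1)`-homogeneous about the centre on the shell: an analytic classical steady Navier–Stokes flow on a full spherical shell about `x₀`
with `curl ≢ 0` and Euler's identity `DV(x)(x − x₀) = −V x` on the shell is infinitesimally axisymmetric about an axis through `x₀`,
with constant (zero) swirl about it — it is a Landau flow centred at `x₀` (Šverák). The unthreaded hypothesis of C♯ is not needed. -/
theorem steadyShellRigidity_of_homogeneous (V : E3 → E3) (p : E3 → ℝ) (x₀ : E3) (r₁ r₂ : ℝ) (hr₁ : 0 < r₁) (h₁₂ : r₁ < r₂)
    (hV : AnalyticOnNhd ℝ V (shell x₀ r₁ r₂)) (hp : AnalyticOnNhd ℝ p (shell x₀ r₁ r₂)) (hNS : IsSteadyNSOn (shell x₀ r₁ r₂) V p)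
    (hcurl : ∃ x ∈ shell x₀ r₁ r₂, curl V x ≠ 0) (hhom : IsMinusOneHomogeneousOn (shell x₀ r₁ r₂) x₀ V) :
    ∃ A : E3 →L[ℝ] E3, IsSkewAxis A ∧ IsEquivariantOn (shell x₀ r₁ r₂) x₀ A V ∧ HasConstantSwirlOn (shell x₀ r₁ r₂) x₀ A V := by
  obtain ⟨a, ha, c, hc, hL⟩ := landau_of_homogeneous hr₁ h₁₂ hV hp hNS hcurl hhom
  obtain ⟨R, hR⟩ := exists_linearIsometryEquiv_apply_eZ_eq ha
  have hc' : 1 < |c| := lt_of_lt_of_le hc (le_abs_self c)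
  obtain ⟨hEq, hSw⟩ := landau_equivariant_noSwirl hc' hr₁ (R := R) hR hL
  exact ⟨conjGen R, isSkewAxis_conjGen R, hEq, hSw⟩

end Homogeneous

end Summit.NavierStokesRegularity.NavierStokesRegularity.Theorems.PoloidalLiouville.AzimuthalCartan

end
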